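import Literature.Computability.Complexity.GapCSP
import HarnessLib

/-!
# Complexity core: gap CSPs in which every variable is queried (Hirahara 2022, Lemma 5.3, compact form)

Companion to `GapCSP.lean`. The MaxCSP instances produced by a PCP verifier (Hirahara 2022,
proof of Thm. 5.2: "Let `Ψ = {C₁, …, C_m}` be the set of constraints over `n` variables … for any
internal randomness `j` of the PCP verifier of Lemma 5.3, there is a constraint `Cⱼ`") have one
variable per *position of the proof*, and a verifier with `r` coins and `D` queries reads at
most `D · 2^r` positions, so the proof — and with it the variable set — may be assumed to consist
of queried positions only (Arora–Barak 2009, Remark 11.6 (2): "The restriction that proofs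
checkable by an `(r, q)`-verifier are of length at most `q2^r` is inconsequential, since such a
verifier can look on at most this number of locations"). The promise problem `gapCSP D Q δ` of
`GapCSP.lean` does not record this: its instances carry the number `n` of variables in binary and
may have `n` exponentially larger than the number of constraints (almost all variables idle),
whereas the parameters `Q(n)`, `δ(n)` are evaluated at `n`. Reductions *from* the gap CSP whose
output size grows with `n` — such as the Dinur–Safra reduction to CMMSA of the proof of
Thm. 5.2, which creates the `n · |Σ|` literals `L_{x,a}` with unary weights
(`CSPToCMMSA.lean`) — are polynomial-time only on instances with `n ≤ poly(|Ψ|)`. This file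
therefore vendors the compact form of Lemma 5.3 that the proof of Thm. 5.2 actually consumes:

* `CSPInstance.AllVarsQueried Ψ` — every variable `x < n` occurs in some constraint (so
  `n ≤ Σⱼ |dom Cⱼ| = mD`, `numVars_le_sum_length_of_allVarsQueried`);
* `gapCSPQueried D Q δ` — `gapCSP D Q δ` with both promise parts restricted to such instances;
  `gapCSPQueried_disjoint`, and `IsHard.of_gapCSPQueried` (hardness of the restricted problem
  gives hardness of `gapCSP`, the promise parts being smaller);
* the named fact `Hirahara2022_lem53_logPow_queried` — Lemma 5.3 in MaxCSP form at soundness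
  `(log n)^{-γ}` for instances in which every variable is queried — and its proved corollary
  for the unrestricted problem `gapCSP` at the same parameters,
  `isNPHard_gapCSP_logPow_of_queried`.

## Provenance and status of the named fact

Hirahara's Lemma 5.3 is printed as "Let `β > 0` be a constant and `δ : ℕ → [0,1]` be a function
such that `δ(n) ≥ 2^{-(log n)^{1-β}}` for all large `n ∈ ℕ`. Then, every language `L ∈ NP`
admits an `O(1/β)`-query PCP system over an alphabet size `poly(1/δ(n))` with randomness
complexity `O(log n)`, soundness error `δ`, and perfect completeness on inputs of length `n`"
(ECCC TR22-119, p. 16), with the attribution "[DFKRS11; DHK15]" and the remark that the main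
result of Dinur–Fischer–Kindler–Raz–Safra is stated only for `δ(n) = 2^{-(log n)^{1-β}}`, the
larger soundness errors being obtained from the streamlined proof of Dinur–Harsha–Kindler. In the
terminology of Dinur–Harsha–Kindler 2015 this is the *sliding scale conjecture* of
Bellare–Goldwasser–Lund–Russell (their Conj. 1.3: for `1/poly(n) ≤ δ < 1`, `O(log n)` coins,
`O(1)` queries, alphabet `poly(1/δ)`, perfect completeness, soundness error `δ`) in the range in
which it is known: "this conjecture is known to hold for `1 > δ ≥ 2^{-(log n)^{1-ε}}`" (§1),
Raz–Safra 1997 and Arora–Sudan 2003 proving it "for all `δ` such that `δ ≥ 2^{-(log n)^β}` for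
some constant `β > 0`" and Dinur–Fischer–Kindler–Raz–Safra 2011 for all `δ ≥ 2^{-(log n)^{1-ε}}`
(their Thm. 1.5: `q = O(1/ε)` queries, alphabet `poly(1/δ)`). The soundness functions vendored
here, `δ(n) = (log n)^{-γ}`, lie in the Raz–Safra/Arora–Sudan range already. The fact is thus an
established theorem; its formalisation, however, amounts to a PCP theorem with sub-constant
error (low-degree testing with sub-constant error and alphabet-reducing proof composition on top
of the basic PCP theorem), none of which exists in Mathlib or in this library (`PCP.lean` and
`PCPSubsetNP.lean` have the Boolean verifier notion and the easy containments only). It is kept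
as a *leaf* of the trust base of `isRandNPHard_MCSPStar` (`MCSPHardnessFromTwoFacts.lean`), to
be threaded as the hypothesis
`(h : Hirahara2022_lem53_logPow_queried)`; the corresponding hardness of the unrestricted problem
`gapCSP` (`GapCSP.lean`) is its corollary `isNPHard_gapCSP_logPow_of_queried` and is not a
separate named fact (an earlier revision vendored that corollary as a second fact,
`Hirahara2022_lem53_logPow`, with no consumer; it was merged into this one).

How the Lean statement follows from the printed one (all steps routine): (1) MaxCSP form and
"exactly `D` variables" as printed on p. 16 (pad a constraint with fresh queried dummy positions
if the verifier asks fewer); (2) discard unqueried positions (Arora–Barak 2009, Remark 11.6 (2)),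
giving `AllVarsQueried` and `n ≤ mD`; (3) the parameters are evaluated at `n = numVars` rather
than at the input length: output `|x|` disjoint copies, so that `|x| ≤ n ≤ poly(|x|)`, and invoke
the lemma at `2γ` with `c` doubled; (4) the strict no-condition `satCount < δ m`: invoke the lemma
at `δ/2`; (5) `c`, `D` uniform in `γ`: fix `β` (so `D = O(1/β)` is one constant) and read
`poly(1/δ)` as one polynomial, as in Conj. 1.3; (6) real, possibly non-computable `γ`: sandwich
`γ ≤ γ₁ ≤ 2γ` with `γ₁ ∈ ℚ` (the no-part grows with `δ`, the alphabet bound with `c`); (7) inputs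
below a fixed length (where `(log₂ n)^{cγ} < 2` would force a unary alphabet) are decided by brute
force inside the reduction and mapped to canned instances — a constant in the running time;
(8) the accepting lists `C⁻¹(1)` have at most `|Σ|^D = polylog(n)` entries, so the instance is
written in polynomial time.

## References

* S. Hirahara, *NP-hardness of learning programs and partial MCSP*, FOCS 2022; ECCC TR22-119:
  Lemma 5.3 and the proof of Thm. 5.2 (p. 16).
* S. Arora, B. Barak, *Computational Complexity: A Modern Approach*, CUP 2009, Def. 11.4 and
  Remark 11.6 (2) (proof length at most `q · 2^r`), §11.3 (PCPs as gap CSPs).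
* I. Dinur, E. Fischer, G. Kindler, R. Raz, S. Safra, *PCP characterizations of NP: toward a
  polynomially-small error-probability*, Comput. Complexity 20 (2011), no. 3 (main theorem;
  restated as Thm. 1.5 of Dinur–Harsha–Kindler 2015).
* I. Dinur, P. Harsha, G. Kindler, *Polynomially low error PCPs with polyloglog n queries via
  modular composition*, STOC 2015 (arXiv:1505.06362): Conj. 1.3 (sliding scale conjecture and the
  range in which it is known), Thm. 1.5 (the DFKRS PCP with `O(1/ε)` queries).
* R. Raz, S. Safra, *A sub-constant error-probability low-degree test, and a sub-constant
  error-probability PCP characterization of NP*, STOC 1997, 475–484.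
* S. Arora, M. Sudan, *Improved low-degree testing and its applications*, Combinatorica 23
  (2003), 365–426.
* M. Bellare, S. Goldwasser, C. Lund, A. Russell, *Efficient probabilistically checkable proofs
  and applications to approximation*, STOC 1993 (the sliding scale conjecture).
-/

namespace Literature.Computability.Complexity

open _root_.Computability

namespace CSPInstance

/-- `Ψ.AllVarsQueried`: every variable `x < n` of the instance occurs in some constraint (for a
PCP-produced instance: every position of the proof is queried for some coin outcome, w.l.o.g. by
Arora–Barak 2009, Remark 11.6 (2)). [cite: AroraBarak2009, Remark 11.6 (2)] -/
def AllVarsQueried (Ψ : CSPInstance) : Prop :=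
  ∀ x < Ψ.numVars, ∃ C ∈ Ψ.constraints, x ∈ C.vars

/-- `AllVarsQueried` is decidable. [folklore] -/
instance decidableAllVarsQueried (Ψ : CSPInstance) : Decidable Ψ.AllVarsQueried := by
  unfold AllVarsQueried
  infer_instance

/-- If every variable is queried then `n ≤ Σⱼ |dom Cⱼ|` (each `x < n` is charged to a
constraint containing it). In particular `n ≤ m · D` for arity `D`. [cite: AroraBarak2009, Remark 11.6 (2)] -/
theorem numVars_le_sum_length_of_allVarsQueried {Ψ : CSPInstance} (h : Ψ.AllVarsQueried) :
    Ψ.numVars ≤ (Ψ.constraints.map fun C => C.vars.length).sum := by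
  classical
  -- `range n ⊆ ⋃ⱼ dom Cⱼ`
  have hsub : Finset.range Ψ.numVars ⊆
      (Ψ.constraints.map fun C : CSPConstraint => C.vars.toFinset).foldr (· ∪ ·) ∅ := by
    intro x hx
    obtain ⟨C, hC, hxC⟩ := h x (Finset.mem_range.1 hx)
    have key : ∀ l : List CSPConstraint, C ∈ l →
        x ∈ (l.map fun C : CSPConstraint => C.vars.toFinset).foldr (· ∪ ·) ∅ := by
      intro l hl
      induction l with
      | nil => simp at hl
      | cons C' l ih =>
        simp only [List.map_cons, List.foldr_cons, Finset.mem_union]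
        rcases List.mem_cons.1 hl with rfl | hl'
        · exact Or.inl (List.mem_toFinset.2 hxC)
        · exact Or.inr (ih hl')
    exact key _ hC
  have hcard : ∀ l : List CSPConstraint,
      ((l.map fun C : CSPConstraint => C.vars.toFinset).foldr (· ∪ ·) ∅).card ≤
        (l.map fun C : CSPConstraint => C.vars.length).sum := by
    intro l
    induction l with
    | nil => simp
    | cons C l ih =>
      simp only [List.map_cons, List.foldr_cons, List.sum_cons]
      exact (Finset.card_union_le _ _).trans (Nat.add_le_add (List.toFinset_card_le _) ih)
  calc Ψ.numVars = (Finset.range Ψ.numVars).card := (Finset.card_range _).symm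
    _ ≤ _ := Finset.card_le_card hsub
    _ ≤ _ := hcard _

end CSPInstance

/-! ### The restricted gap problem -/

namespace GapCSPQueried

/-- Yes-instances: those of `GapCSP.yesSet D Q` in which every variable is queried.
[cite: Hirahara2022PartialMCSP, Lemma 5.3 and proof of Thm. 5.2 (p. 16)] -/
def yesSet (D : ℕ) (Q : ℕ → ℝ) : Set CSPInstance :=
  {Ψ | Ψ ∈ GapCSP.yesSet D Q ∧ Ψ.AllVarsQueried}

/-- No-instances: those of `GapCSP.noSet D Q δ` in which every variable is queried.
[cite: Hirahara2022PartialMCSP, Lemma 5.3 and proof of Thm. 5.2 (p. 16)] -/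
def noSet (D : ℕ) (Q δ : ℕ → ℝ) : Set CSPInstance :=
  {Ψ | Ψ ∈ GapCSP.noSet D Q δ ∧ Ψ.AllVarsQueried}

/-- The restricted yes-part is contained in the unrestricted one. [folklore] -/
theorem yesSet_subset (D : ℕ) (Q : ℕ → ℝ) : yesSet D Q ⊆ GapCSP.yesSet D Q :=
  fun _ h => h.1

/-- The restricted no-part is contained in the unrestricted one. [folklore] -/
theorem noSet_subset (D : ℕ) (Q δ : ℕ → ℝ) : noSet D Q δ ⊆ GapCSP.noSet D Q δ :=
  fun _ h => h.1

/-- For soundness `δ ≤ 1` the restricted yes- and no-instances are disjoint.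
[cite: Hirahara2022PartialMCSP, Lemma 5.3] -/
theorem disjoint_yesSet_noSet {D : ℕ} {Q δ : ℕ → ℝ} (hδ : ∀ n, δ n ≤ 1) :
    Disjoint (yesSet D Q) (noSet D Q δ) :=
  Set.disjoint_of_subset (yesSet_subset D Q) (noSet_subset D Q δ) (GapCSP.disjoint_yesSet_noSet hδ)

end GapCSPQueried

/-- The promise problem **gap CSP with arity `D`, alphabet bound `Q`, soundness `δ`, every
variable queried**: `gapCSP D Q δ` (`GapCSP.lean`) with both promise parts restricted to
instances satisfying `AllVarsQueried` — the MaxCSP instances a `D`-query PCP verifier yields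
once idle proof positions are discarded (Arora–Barak 2009, Remark 11.6 (2)).
[cite: Hirahara2022PartialMCSP, Lemma 5.3 and proof of Thm. 5.2 (p. 16)] -/
def gapCSPQueried (D : ℕ) (Q δ : ℕ → ℝ) : PromiseProblem :=
  PromiseProblem.ofEncoding CSPInstance.encoding (GapCSPQueried.yesSet D Q)
    (GapCSPQueried.noSet D Q δ)

/-- The yes-part of `gapCSPQueried D Q δ` (definitional). [folklore] -/
@[simp] theorem gapCSPQueried_yes (D : ℕ) (Q δ : ℕ → ℝ) :
    (gapCSPQueried D Q δ).yes = CSPInstance.encoding.toLanguage (GapCSPQueried.yesSet D Q) := rfl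

/-- The no-part of `gapCSPQueried D Q δ` (definitional). [folklore] -/
@[simp] theorem gapCSPQueried_no (D : ℕ) (Q δ : ℕ → ℝ) :
    (gapCSPQueried D Q δ).no = CSPInstance.encoding.toLanguage (GapCSPQueried.noSet D Q δ) := rfl

/-- For `δ ≤ 1`, `gapCSPQueried D Q δ` is a genuine (disjoint) promise problem. [cite: Hirahara2022PartialMCSP, Lemma 5.3] -/
theorem gapCSPQueried_disjoint {D : ℕ} {Q δ : ℕ → ℝ} (hδ : ∀ n, δ n ≤ 1) :
    (gapCSPQueried D Q δ).Disjoint :=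
  PromiseProblem.disjoint_ofEncoding _ (GapCSPQueried.disjoint_yesSet_noSet hδ)

/-- **Hardness transfers to the unrestricted problem**: a Karp reduction into
`gapCSPQueried D Q δ` is one into `gapCSP D Q δ` (both promise parts only grow).
[cite: Goldreich2006, Def. 1.4] -/
theorem PromiseProblem.IsHard.of_gapCSPQueried {C : Set (Language Bool)} {D : ℕ} {Q δ : ℕ → ℝ}
    (h : (gapCSPQueried D Q δ).IsHard C) : (gapCSP D Q δ).IsHard C := by
  intro L hL
  obtain ⟨f, hf, hy, hn⟩ := h L hL
  refine ⟨f, hf, fun x hx => ?_, fun x hx => ?_⟩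
  · exact Encoding.toLanguage_mono _ (GapCSPQueried.yesSet_subset D Q) (hy hx)
  · exact Encoding.toLanguage_mono _ (GapCSPQueried.noSet_subset D Q δ) (hn hx)

/-! ### Lemma 5.3, compact form -/

/-- **Hirahara 2022, Lemma 5.3 (Dinur–Fischer–Kindler–Raz–Safra 2011; Dinur–Harsha–Kindler 2015)
in MaxCSP form at soundness `δ(n) = (log n)^{-γ}`, for instances in which every variable is
queried.** For the gap CSP of `GapCSP.lean` at the parameters of the proof of Thm. 5.2: there
are constants `D ≥ 1` and `c` such that for every real `γ > 0` the
promise problem with arity exactly `D`, alphabet `|Σ| ≤ (log₂ n)^{c γ}` and soundness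
`(log₂ n)^{-γ}` is NP-hard under polynomial-time Karp reductions of promise problems — here for
`gapCSPQueried`, i.e. with the promise that every variable (position of the PCP proof) occurs in
some constraint (is queried for some coin outcome), which the verifier of Lemma 5.3 may be
assumed to satisfy by discarding the positions it never reads (Arora–Barak 2009,
Remark 11.6 (2)); then `n ≤ mD`, as for the CSPs of the printed proof, whose variables are the
proof positions. Hardness survives the trimming although `Q` and `δ` are evaluated at the
possibly smaller number `n̂` of queried positions: replace the trimmed instance on input `x` by
`|x|` disjoint copies of itself (still all-queried, same fraction of simultaneously satisfiable
constraints, now `|x| ≤ n ≤ poly(|x|)` variables), so that `log n = Θ(log |x|)`, and invoke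
Lemma 5.3 at `2γ` with `c` doubled to absorb the constant factors (see the module docstring,
"Provenance and status", for the remaining routine steps and for the primary sources of the
lemma). This is the form consumed by the Dinur–Safra reduction
(`CSPToCMMSA.lean`), whose output has `n · |Σ|` variables with unary weights. It implies the
same hardness for the unrestricted problem `gapCSP` (`isNPHard_gapCSP_logPow_of_queried`).
[cite: Hirahara2022PartialMCSP, Lemma 5.3 (MaxCSP form, proof of Thm. 5.2, p. 16) at δ(n) = (log n)^{-γ}, every proof position queried (Arora–Barak 2009, Remark 11.6 (2))] -/
def Hirahara2022_lem53_logPow_queried : Prop :=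
  ∃ D c : ℕ, 0 < D ∧ ∀ γ : ℝ, 0 < γ →
    (gapCSPQueried D (fun n => (Nat.log 2 n : ℝ) ^ ((c : ℝ) * γ))
      (fun n => (Nat.log 2 n : ℝ) ^ (-γ))).IsNPHard

/-- The compact form of Lemma 5.3 gives the same NP-hardness for the unrestricted gap problem
`gapCSP` of `GapCSP.lean` (both promise parts only grow, `IsHard.of_gapCSPQueried`); this
corollary is a proved theorem, not a separate named fact. [cite: Hirahara2022PartialMCSP, Lemma 5.3] -/
theorem isNPHard_gapCSP_logPow_of_queried (h : Hirahara2022_lem53_logPow_queried) :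
    ∃ D c : ℕ, 0 < D ∧ ∀ γ : ℝ, 0 < γ →
      (gapCSP D (fun n => (Nat.log 2 n : ℝ) ^ ((c : ℝ) * γ))
        (fun n => (Nat.log 2 n : ℝ) ^ (-γ))).IsNPHard := by
  obtain ⟨D, c, hD, hhard⟩ := h
  exact ⟨D, c, hD, fun γ hγ => (hhard γ hγ).of_gapCSPQueried⟩

end Literature.Computability.Complexity
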